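import Mathlib
import Literature.MathematicalPhysics.QuantumFieldTheory.Balaban1983to89.B6Prop23Chain
import Literature.MathematicalPhysics.QuantumFieldTheory.Balaban1983to89.B5Eq118OneStroke

/-!
# `Balaban1983to89.B6Ineq2142` — T. Bałaban, *Propagators and renormalization transformations for lattice gauge
theories. II*, Commun. Math. Phys. **96** (1984) 223–250 [Balaban1984PropagatorsII], p. 248: *"From (2.136) we have
(2.142)"* — the kernel bound (2.142) of `QGQ*` DERIVED from the first entry of (2.136) by the weighted-adjoint
bookkeeping of the pairing (2.69), kernel-checked, in exactly the shape consumed by `…B6Prop27Kernel` (p = 2)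

statement-level skeleton of published theorems with citation tags; proofs where landed; nothing here is a claim about the Yang–Mills mass gap

CITATION HEADER (cell `lit-balaban`, HOME `run/shared/lean/pub/lit-balaban/`; unit `lit-balaban-r03` gen 5 = the B6
reader/fold owner; SKELETON row **B6.Eq2.142** of `HOME/lit-balaban-r03/ROWS-B6.md`, Phase-2 kind «knitting implication»
(PHASE2-TARGETS §G.2(b)); TAKING line HOME/STATUS.md 2026-08-21T05:03Z).  Source held: `paper:balaban1984-cmp96-propagators-rt-ii`
(journal page = PDF page + 222); p. 248 [PDF 26], p. 247 [PDF 25] and p. 235 [PDF 13] were re-read AS IMAGES on the renders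
`run/shared/lean/pub/pub-balaban/b2b-balaban-ref1/pages/1984-cmp96-propagators-rt-II/1984-cmp96-propagators-rt-II-p026-x2.png`,
`…-p025-x2.png`, `…-p013-x2.png`; [Balaban1984PropagatorsI] (1.18) p. 20 from the tree transcription `…B5Eq118OneStroke`.
IMPORTED, NOT MODIFIED: `…B6Expansion282` (`kerOp` = kernel operators in the pairing (2.69)), `…B6Prop23Chain` (`mat`,
`apply_eq_sum_mat`), `…B6` (`B6.Geometry`, `Geometry.len`), `…LatticeFieldCalculus` (`bondAvgIter`, `runSite`, `runBond`,
`segSum`), `…B5Eq118OneStroke` (`iterBlock`, `card_iterBlock`, the one-stroke formula `eq118`).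

WHAT THE PAPER PRINTS.  p. 248 [PDF 26], verbatim: *"Finally let us consider the operator QGQ* and its inverse. We consider
these operators on the L²-space defined by (2.69) with sites replaced by bonds. The operator QGQ* is positive, hence the
inverse is well defined and positive also. We want to prove similar bounds as for the operator Q′G′²Q′* and we will follow
rather closely the arguments given for it. From (2.136) we have
|(QGQ*)(b, b′)| ≤ O(1)(L^jη)²(L^{j′}η)^{−d}e^{−δ₃d(b,b′)}, b ∈ Λ_j, b′ ∈ Λ_{j′}. (2.142)"*; further down the same page:
*"… with ⟨A, J⟩ replaced by ⟨A, Q*B⟩ = ⟨QA, B⟩."*  p. 235 [PDF 13], (2.69): *"⟨λ, λ′⟩ = Σ_j Σ_{y∈Λ_j} (L^jη)^d λ(y)λ′(y)"*.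
p. 247 [PDF 25], the first entry of (2.136) (Proposition 2.6): *"|(GJ)(x)| … ≤ O(1)[(L^jη)², …]e^{−δ₃d(y,y′)}|J| for x ∈ Δ(y),
y ∈ Λ_j, supp J ⊂ Δ(y′), with the constant O(1) depending on d and L only"*.  [Balaban1984PropagatorsI] (1.18) p. 20:
*"(Q_kA)_b = Σ_{x∈B^k(b₋)} η^{d+1} A([x, x(b)])"*.

WHAT IS PROVED HERE (0 `sorry`, 0 new named facts, axioms = the standard three).
§1 The averaging operator `Q` with kernel `q(b,x)` (`avgOp`), the two pairings — `⟨A,A′⟩ = Σ_x w_X A(x)A′(x)` on the fine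
   lattice (w_X = η^d, [Balaban1984PropagatorsI] (1.5)) and (2.69) `⟨B,B′⟩ = Σ_b W(b)B(b)B′(b)`, `W(b) = (L^{j(b)}η)^d` — and THE
   adjoint `Q*` of the printed sentence *"⟨A, Q*B⟩ = ⟨QA, B⟩"*: `avgAdj`, `(Q*B)(x) = w_X⁻¹ Σ_b W(b)q(b,x)B(b)`, with
   `adjoint` (it is an adjoint) and `adjoint_unique` (it is the only one).
§2 The two sup-norm facts the sentence *"From (2.136) we have (2.142)"* uses silently: `abs_avgOp_le` (Q does not increase
   sup norms beyond the ℓ¹-mass `κ₁ ≥ Σ_x|q(b,x)|` of its kernel, and only sees the fine points of the region `R(b) ⊇ supp q(b,·)`)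
   and `abs_avgAdj_single_le` / `avgAdj_single_support` (`Q*δ_{b′}` is supported in `R(b′)` and bounded by `κ₂` as soon as
   `|q(b′,x)| ≤ κ₂·w_X/W(b′)` — the averaging normalisation: each fine point carries the relative volume η^d/(L^{j′}η)^d).
§3 `ineq2142_of_2136`: for ANY linear `G` on the fine lattice satisfying the first entry of (2.136) in operator form
   (`|(GJ)(x)| ≤ C·ℓ(b)²·e^{−δ₃ρ(b,b′)}·sup|J|` for `x ∈ R(b)`, `supp J ⊂ R(b′)`), the matrix entry of `QGQ*` obeys
   `|(QGQ*δ_{b′})(b)| ≤ κ₁κ₂·C·ℓ(b)²·e^{−δ₃ρ(b,b′)}`; since the kernel of an operator in the pairing (2.69) is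
   `X(b,b′) = (Tδ_{b′})(b)/W(b′)` (`kernelW`, `kerOp_kernelW`: `kerOp W (kernelW W T) = T`), this IS (2.142):
   `|(QGQ*)(b,b′)| ≤ κ₁κ₂·O(1)·(L^jη)²(L^{j′}η)^{−d}e^{−δ₃d(b,b′)}` (`ineq2142_kernel`).
§4 `hX_of_2136`: the same over the cell's carrier `B6.Geometry` (sites of `g` = the bonds of 𝔅, *"sites replaced by bonds"*),
   `W = len^d`, `ℓ = len`, rate written `½δ₀` := δ₃ — LITERALLY the hypothesis `hX` (at p = 2) of
   `…B6Prop27Kernel.inverse_assembled_pow` / `mat_R_abs_le_pow`, for the actual operator `Q ∘ G ∘ Q*`, with `BX = κ₁κ₂C`.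
§5 The averaging normalisation is NOT left as a hypothesis for the printed average: for the k-fold linear bond average
   `Q_k = LatticeFieldCalculus.bondAvgIter k` ([Balaban1984PropagatorsI] (1.16)–(1.18)) the kernel is exhibited (`qIter`,
   `bondAvgIter_eq_avgOp` via the one-stroke formula `B5Eq118OneStroke.eq118`), and `Σ_β q_k(b,β) = 1` (`sum_qIter`, exact),
   `0 ≤ q_k ≤ η^d` (`qIter_nonneg`, `qIter_le`: at most `L^k` contours of a block pass through a given fine bond,
   `runSite_injective`) are PROVED — i.e. `κ₁ = κ₂ = 1` with `w_X = η^d`, `W ≡ 1` on the unit lattice `T^{(k)}`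
   (`qIter_normalisation`, `ineq2142_bondAvgIter`).
HONEST SCOPE.  (2.136) itself (Proposition 2.6) is NOT proved here — it enters in operator form as the displayed hypothesis;
the regions `R(b)` are parameters (the print's `Δ(y)`, `Δ(y′)` ⊇ the supports of the averaging contours); the multi-level
averaging of B6 (Q_j on Λ_j, Q_{j+1} on B^j(Λ), p. 239) is covered by §3–§4 for any kernel with the two normalisation
constants, and instantiated in §5 for one level k only.  Value = a kernel-checked derivation step of the paper + the
normalisation constants of the printed average; NOT summit progress.v1.1 (APPEND-ONLY, r03 gen 5): §6 = (2.144)₁ p. 248, `⟨B,(QG_□Q*)B⟩_η = (L^jη)^{d+2}⟨B,(QG^ξ_□Q*)B⟩_ξ` — the form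
rescaling behind row `B6.Eq2.144` (`eq2144_rescaling`, with `avgAdj_scale`: Q* is scale-free; `pairS_scale`).
-/

namespace Literature.MathematicalPhysics.QuantumFieldTheory.Balaban1983to89.B6Ineq2142

open Finset
open B6Expansion282 (kerOp kerOp_apply)
open B6Prop23Chain (mat apply_eq_sum_mat)

/-! ## §1 The averaging operator, the pairings, and the adjoint `Q*` -/

section Weighted

variable {X S : Type} [Fintype X] [Fintype S]

/-- The linear averaging operator with kernel `q`: `(QA)(b) = Σ_x q(b,x)A(x)` (for `Q_k` of [Balaban1984PropagatorsI] (1.18),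
`q(b,x) = η^{d+1}·#{contours of B^k(b₋) through x}`, §5). [cite: Balaban1984PropagatorsI, (1.18) p.20] -/
def avgOp (q : S → X → ℝ) : (X → ℝ) →ₗ[ℝ] (S → ℝ) where
  toFun A := fun b => ∑ x, q b x * A x
  map_add' A A' := by
    funext b
    simp only [Pi.add_apply, mul_add, Finset.sum_add_distrib]
  map_smul' r A := by
    funext b
    simp only [Pi.smul_apply, smul_eq_mul, RingHom.id_apply, Finset.mul_sum]
    exact Finset.sum_congr rfl fun _ _ => by ring

omit [Fintype S] in
/-- `(QA)(b) = Σ_x q(b,x)A(x)`. [cite: Balaban1984PropagatorsI, (1.18) p.20] -/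
@[simp] theorem avgOp_apply (q : S → X → ℝ) (A : X → ℝ) (b : S) : avgOp q A b = ∑ x, q b x * A x := rfl

/-- The pairing of the fine lattice, `⟨A, A′⟩ = Σ_x w_X A(x)A′(x)`, `w_X = η^d`. [cite: Balaban1984PropagatorsI, (1.5) p.18] -/
def pairX (wX : ℝ) (A A' : X → ℝ) : ℝ := ∑ x, wX * (A x * A' x)

/-- The pairing (2.69) on 𝔅 (sites replaced by bonds, p. 248): `⟨B, B′⟩ = Σ_b W(b)B(b)B′(b)`, `W(b) = (L^{j(b)}η)^d`.
[cite: Balaban1984PropagatorsII, (2.69) p.235] -/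
def pairS (W : S → ℝ) (B B' : S → ℝ) : ℝ := ∑ b, W b * (B b * B' b)

/-- The adjoint `Q*` of `Q` with respect to the two pairings: `(Q*B)(x) = w_X⁻¹ Σ_b W(b)q(b,x)B(b)`.
[cite: Balaban1984PropagatorsII, p.248] -/
noncomputable def avgAdj (wX : ℝ) (W : S → ℝ) (q : S → X → ℝ) : (S → ℝ) →ₗ[ℝ] (X → ℝ) where
  toFun B := fun x => wX⁻¹ * ∑ b, W b * q b x * B b
  map_add' B B' := by
    funext x
    simp only [Pi.add_apply, mul_add, Finset.sum_add_distrib]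
  map_smul' r B := by
    funext x
    simp only [Pi.smul_apply, smul_eq_mul, RingHom.id_apply, Finset.mul_sum]
    exact Finset.sum_congr rfl fun _ _ => by ring

omit [Fintype X] in
/-- `(Q*B)(x) = w_X⁻¹ Σ_b W(b)q(b,x)B(b)`. [cite: Balaban1984PropagatorsII, p.248] -/
@[simp] theorem avgAdj_apply (wX : ℝ) (W : S → ℝ) (q : S → X → ℝ) (B : S → ℝ) (x : X) :
    avgAdj wX W q B x = wX⁻¹ * ∑ b, W b * q b x * B b := rfl

/-- **`⟨QA, B⟩ = ⟨A, Q*B⟩`** (p. 248: *"⟨A, Q*B⟩ = ⟨QA, B⟩"*): `avgAdj` is an adjoint of `avgOp` for the pairings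
`pairX wX` (fine lattice) and `pairS W` ((2.69)). [cite: Balaban1984PropagatorsII, p.248] -/
theorem adjoint {wX : ℝ} (hwX : wX ≠ 0) (W : S → ℝ) (q : S → X → ℝ) (A : X → ℝ) (B : S → ℝ) :
    pairS W (avgOp q A) B = pairX wX A (avgAdj wX W q B) := by
  simp only [pairS, pairX, avgOp_apply, avgAdj_apply, Finset.sum_mul, Finset.mul_sum]
  rw [Finset.sum_comm]
  refine Finset.sum_congr rfl fun x _ => Finset.sum_congr rfl fun b _ => ?_
  field_simp

/-- `⟨δ_x, F⟩ = w_X F(x)`: the fine pairing is non-degenerate for `w_X ≠ 0`. [folklore] -/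
private theorem pairX_single [DecidableEq X] (wX : ℝ) (x : X) (F : X → ℝ) :
    pairX wX (Pi.single x 1) F = wX * F x := by
  unfold pairX
  rw [Finset.sum_eq_single x]
  · simp
  · intro y _ hy
    simp [hy]
  · intro h
    exact (h (Finset.mem_univ x)).elim

/-- **Uniqueness of the adjoint**: any operator `T` with `⟨QA, B⟩ = ⟨A, TB⟩` for all `A, B` IS `avgAdj` (`w_X ≠ 0`).
[cite: Balaban1984PropagatorsII, p.248] -/
theorem adjoint_unique [DecidableEq X] {wX : ℝ} (hwX : wX ≠ 0) (W : S → ℝ) (q : S → X → ℝ)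
    (T : (S → ℝ) →ₗ[ℝ] (X → ℝ)) (hT : ∀ A B, pairS W (avgOp q A) B = pairX wX A (T B)) :
    T = avgAdj wX W q := by
  refine LinearMap.ext fun B => funext fun x => ?_
  have h1 := hT (Pi.single x 1) B
  rw [adjoint hwX W q, pairX_single, pairX_single] at h1
  exact (mul_right_injective₀ hwX h1).symm

/-! ## §2 Sup-norm bookkeeping for `Q` and `Q*δ_{b′}` -/

omit [Fintype S] in
/-- `Q` is sup-bounded by the ℓ¹-mass of its kernel: if `|F| ≤ M` on the region `R(b) ⊇ supp q(b,·)` and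
`Σ_x|q(b,x)| ≤ κ₁` then `|(QF)(b)| ≤ κ₁M`. [cite: Balaban1984PropagatorsII, (2.142) p.248] -/
theorem abs_avgOp_le (q : S → X → ℝ) {R : S → Set X} (hqR : ∀ b x, q b x ≠ 0 → x ∈ R b) {κ₁ : ℝ}
    (hq1 : ∀ b, ∑ x, |q b x| ≤ κ₁) (F : X → ℝ) (b : S) {M : ℝ} (hM : 0 ≤ M) (hF : ∀ x ∈ R b, |F x| ≤ M) :
    |avgOp q F b| ≤ κ₁ * M := by
  rw [avgOp_apply]
  calc |∑ x, q b x * F x| ≤ ∑ x, |q b x * F x| := Finset.abs_sum_le_sum_abs _ _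
    _ ≤ ∑ x, |q b x| * M := by
        refine Finset.sum_le_sum fun x _ => ?_
        rw [abs_mul]
        by_cases hq : q b x = 0
        · simp [hq]
        · exact mul_le_mul_of_nonneg_left (hF x (hqR b x hq)) (abs_nonneg _)
    _ = (∑ x, |q b x|) * M := (Finset.sum_mul _ _ _).symm
    _ ≤ κ₁ * M := mul_le_mul_of_nonneg_right (hq1 b) hM

omit [Fintype X] in
/-- `(Q*δ_{b′})(x) = w_X⁻¹·W(b′)·q(b′,x)`. [cite: Balaban1984PropagatorsII, p.248] -/
theorem avgAdj_single [DecidableEq S] (wX : ℝ) (W : S → ℝ) (q : S → X → ℝ) (b' : S) (x : X) :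
    avgAdj wX W q (Pi.single b' 1) x = wX⁻¹ * (W b' * q b' x) := by
  rw [avgAdj_apply]
  congr 1
  rw [Finset.sum_eq_single b']
  · simp
  · intro b _ hb
    simp [hb]
  · intro h
    exact (h (Finset.mem_univ b')).elim

omit [Fintype X] in
/-- `Q*δ_{b′}` is supported where `q(b′,·)` is, i.e. inside `R(b′)`. [cite: Balaban1984PropagatorsII, (2.142) p.248] -/
theorem avgAdj_single_support [DecidableEq S] {q : S → X → ℝ} {R : S → Set X}
    (hqR : ∀ b x, q b x ≠ 0 → x ∈ R b) (wX : ℝ) (W : S → ℝ) {b' : S} {x : X}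
    (hx : avgAdj wX W q (Pi.single b' 1) x ≠ 0) : x ∈ R b' := by
  rw [avgAdj_single] at hx
  refine hqR b' x fun hq => hx ?_
  rw [hq, mul_zero, mul_zero]

omit [Fintype X] in
/-- **The averaging normalisation**: if every fine point carries at most the relative volume `κ₂·w_X/W(b′)`
(`|q(b′,x)| ≤ κ₂η^d/(L^{j′}η)^d`), then `|Q*δ_{b′}| ≤ κ₂` pointwise. [cite: Balaban1984PropagatorsII, (2.142) p.248] -/
theorem abs_avgAdj_single_le [DecidableEq S] {wX : ℝ} (hwX : 0 < wX) {W : S → ℝ} (hW : ∀ b, 0 < W b)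
    {q : S → X → ℝ} {κ₂ : ℝ} (hq2 : ∀ b x, |q b x| ≤ κ₂ * wX / W b) (b' : S) (x : X) :
    |avgAdj wX W q (Pi.single b' 1) x| ≤ κ₂ := by
  rw [avgAdj_single, abs_mul, abs_mul, abs_inv, abs_of_pos hwX, abs_of_pos (hW b')]
  have hWb := hW b'
  calc wX⁻¹ * (W b' * |q b' x|) ≤ wX⁻¹ * (W b' * (κ₂ * wX / W b')) :=
        mul_le_mul_of_nonneg_left (mul_le_mul_of_nonneg_left (hq2 b' x) hWb.le) (inv_nonneg.mpr hwX.le)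
    _ = κ₂ := by
        field_simp

/-! ## §3 (2.136)₁ ⟹ (2.142) -/

/-- The matrix entry of `QGQ*`: `(QGQ*δ_{b′})(b) = (Q(G(Q*δ_{b′})))(b)`. [folklore] -/
private theorem mat_comp_eq [DecidableEq S] (q : S → X → ℝ) (G : Module.End ℝ (X → ℝ)) (wX : ℝ) (W : S → ℝ) (b b' : S) :
    mat (avgOp q ∘ₗ G ∘ₗ avgAdj wX W q) b b' = avgOp q (G (avgAdj wX W q (Pi.single b' 1))) b := rfl

/-- **(2.136)₁ ⟹ (2.142), matrix form.**  For any linear `G` on the fine lattice with the first entry of (2.136) in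
operator form — `|(GJ)(x)| ≤ C·ℓ(b)²·e^{−δ₃ρ(b,b′)}·M` for `x ∈ R(b)` whenever `supp J ⊂ R(b′)` and `|J| ≤ M` — and any
averaging kernel with `Σ_x|q(b,x)| ≤ κ₁`, `|q(b,x)| ≤ κ₂w_X/W(b)`, supported in the regions `R`:
`|(QGQ*δ_{b′})(b)| ≤ κ₁κ₂·C·ℓ(b)²·e^{−δ₃ρ(b,b′)}`. [cite: Balaban1984PropagatorsII, (2.142) p.248] -/
theorem ineq2142_of_2136 [DecidableEq S] (G : Module.End ℝ (X → ℝ)) (q : S → X → ℝ) (R : S → Set X)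
    {wX : ℝ} {W : S → ℝ} (ℓ : S → ℝ) (ρ : S → S → ℝ) {C δ₃ κ₁ κ₂ : ℝ}
    (hwX : 0 < wX) (hW : ∀ b, 0 < W b) (hC : 0 ≤ C) (hκ₂ : 0 ≤ κ₂)
    (hqR : ∀ b x, q b x ≠ 0 → x ∈ R b) (hq1 : ∀ b, ∑ x, |q b x| ≤ κ₁)
    (hq2 : ∀ b x, |q b x| ≤ κ₂ * wX / W b)
    (h2136 : ∀ (b b' : S) (J : X → ℝ) (M : ℝ), (∀ x, J x ≠ 0 → x ∈ R b') → (∀ x, |J x| ≤ M) →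
      ∀ x ∈ R b, |G J x| ≤ C * ℓ b ^ 2 * Real.exp (-(δ₃ * ρ b b')) * M)
    (b b' : S) :
    |mat (avgOp q ∘ₗ G ∘ₗ avgAdj wX W q) b b'| ≤ κ₁ * κ₂ * C * ℓ b ^ 2 * Real.exp (-(δ₃ * ρ b b')) := by
  rw [mat_comp_eq]
  set J := avgAdj wX W q (Pi.single b' 1) with hJ
  have hJsupp : ∀ x, J x ≠ 0 → x ∈ R b' := fun x hx => avgAdj_single_support hqR wX W hx
  have hJle : ∀ x, |J x| ≤ κ₂ := fun x => abs_avgAdj_single_le hwX hW hq2 b' x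
  have hG : ∀ x ∈ R b, |G J x| ≤ C * ℓ b ^ 2 * Real.exp (-(δ₃ * ρ b b')) * κ₂ :=
    h2136 b b' J κ₂ hJsupp hJle
  have hM : 0 ≤ C * ℓ b ^ 2 * Real.exp (-(δ₃ * ρ b b')) * κ₂ := by positivity
  calc |avgOp q (G J) b| ≤ κ₁ * (C * ℓ b ^ 2 * Real.exp (-(δ₃ * ρ b b')) * κ₂) :=
        abs_avgOp_le q hqR hq1 (G J) b hM hG
    _ = κ₁ * κ₂ * C * ℓ b ^ 2 * Real.exp (-(δ₃ * ρ b b')) := by ring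

/-- The kernel of an operator `T` on 𝔅 in the pairing (2.69): `X(b,b′) = (Tδ_{b′})(b)/W(b′)`, so that
`(TB)(b) = Σ_{b′} W(b′)X(b,b′)B(b′)` (`kerOp_kernelW`). [cite: Balaban1984PropagatorsII, (2.69) p.235] -/
noncomputable def kernelW [DecidableEq S] (W : S → ℝ) (T : Module.End ℝ (S → ℝ)) : S → S → ℝ :=
  fun b b' => mat T b b' / W b'

/-- `kerOp W (kernelW W T) = T`: every operator on the finite space 𝔅 is the kernel operator of its (2.69)-kernel.
[cite: Balaban1984PropagatorsII, (2.69) p.235] -/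
theorem kerOp_kernelW [DecidableEq S] {W : S → ℝ} (hW : ∀ b, W b ≠ 0) (T : Module.End ℝ (S → ℝ)) :
    kerOp W (kernelW W T) = T := by
  refine LinearMap.ext fun μ => funext fun y => ?_
  rw [kerOp_apply, apply_eq_sum_mat]
  refine Finset.sum_congr rfl fun y' _ => ?_
  unfold kernelW
  rw [mul_div_cancel₀ _ (hW y')]

omit [Fintype X] [Fintype S] in
/-- `W(b′)·X(b,b′) = (Tδ_{b′})(b)`. [folklore] -/
private theorem mul_kernelW [DecidableEq S] {W : S → ℝ} (hW : ∀ b, W b ≠ 0) (T : Module.End ℝ (S → ℝ)) (b b' : S) :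
    W b' * kernelW W T b b' = mat T b b' := by
  unfold kernelW
  rw [mul_div_cancel₀ _ (hW b')]

/-- **(2.142), kernel form**: with `W(b′) = (L^{j′}η)^d` and `ℓ(b) = L^jη`,
`|(QGQ*)(b,b′)| ≤ κ₁κ₂·C·(L^jη)²·(L^{j′}η)^{−d}·e^{−δ₃ρ(b,b′)}` for the (2.69)-kernel of `QGQ*`.
[cite: Balaban1984PropagatorsII, (2.142) p.248] -/
theorem ineq2142_kernel [DecidableEq S] (G : Module.End ℝ (X → ℝ)) (q : S → X → ℝ) (R : S → Set X)
    {wX : ℝ} {W : S → ℝ} (ℓ : S → ℝ) (ρ : S → S → ℝ) {C δ₃ κ₁ κ₂ : ℝ}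
    (hwX : 0 < wX) (hW : ∀ b, 0 < W b) (hC : 0 ≤ C) (hκ₂ : 0 ≤ κ₂)
    (hqR : ∀ b x, q b x ≠ 0 → x ∈ R b) (hq1 : ∀ b, ∑ x, |q b x| ≤ κ₁)
    (hq2 : ∀ b x, |q b x| ≤ κ₂ * wX / W b)
    (h2136 : ∀ (b b' : S) (J : X → ℝ) (M : ℝ), (∀ x, J x ≠ 0 → x ∈ R b') → (∀ x, |J x| ≤ M) →
      ∀ x ∈ R b, |G J x| ≤ C * ℓ b ^ 2 * Real.exp (-(δ₃ * ρ b b')) * M)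
    (b b' : S) :
    |kernelW W (avgOp q ∘ₗ G ∘ₗ avgAdj wX W q) b b'| ≤
      κ₁ * κ₂ * C * ℓ b ^ 2 * (W b')⁻¹ * Real.exp (-(δ₃ * ρ b b')) := by
  have hWb := hW b'
  have h := ineq2142_of_2136 G q R ℓ ρ hwX hW hC hκ₂ hqR hq1 hq2 h2136 b b'
  unfold kernelW
  rw [abs_div, abs_of_pos hWb, div_le_iff₀ hWb]
  calc |mat (avgOp q ∘ₗ G ∘ₗ avgAdj wX W q) b b'| ≤ κ₁ * κ₂ * C * ℓ b ^ 2 * Real.exp (-(δ₃ * ρ b b')) := h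
    _ = κ₁ * κ₂ * C * ℓ b ^ 2 * (W b')⁻¹ * Real.exp (-(δ₃ * ρ b b')) * W b' := by
        field_simp

end Weighted

/-! ## §4 The hypothesis `hX` of `…B6Prop27Kernel` (p = 2) for the operator `Q ∘ G ∘ Q*` -/

section Geometry

open B6

/-- **(2.142) in the shape consumed by Proposition 2.7's kernel chain**: over the carrier `g : B6.Geometry` (its sites
are the bonds of 𝔅 — p. 248 *"sites replaced by bonds"*), weights `W = len^d` of (2.69), `ℓ = len`, and the rate written
`½δ₀ := δ₃` as in `…B6Prop27Kernel`, the (2.69)-kernel `X` of `QGQ*` satisfies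
`|len(y″)^d·X(y,y″)| ≤ (κ₁κ₂C)·len(y)²·e^{−½δ₀d(y,y″)}` — LITERALLY the hypothesis `hX` of
`B6Prop27Kernel.inverse_assembled_pow` at `p = 2`, for `kerOp (len^d) X = Q ∘ G ∘ Q*` (`kerOp_kernelW`).
[cite: Balaban1984PropagatorsII, (2.142) p.248] -/
theorem hX_of_2136 (g : Geometry) [DecidableEq g.Site] (d : ℕ) {Y : Type} [Fintype Y]
    (G : Module.End ℝ (Y → ℝ)) (q : g.Site → Y → ℝ) (R : g.Site → Set Y) {wX C δ₀ κ₁ κ₂ : ℝ}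
    (hwX : 0 < wX) (hL : 0 < g.L) (hη : 0 < g.eta) (hC : 0 ≤ C) (hκ₂ : 0 ≤ κ₂)
    (hqR : ∀ b x, q b x ≠ 0 → x ∈ R b) (hq1 : ∀ b, ∑ x, |q b x| ≤ κ₁)
    (hq2 : ∀ b x, |q b x| ≤ κ₂ * wX / g.len b ^ d)
    (h2136 : ∀ (b b' : g.Site) (J : Y → ℝ) (M : ℝ), (∀ x, J x ≠ 0 → x ∈ R b') → (∀ x, |J x| ≤ M) →
      ∀ x ∈ R b, |G J x| ≤ C * g.len b ^ 2 * Real.exp (-(1 / 2 * δ₀ * g.dist b b')) * M) :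
    ∀ y y'', |g.len y'' ^ d *
        kernelW (fun z => g.len z ^ d) (avgOp q ∘ₗ G ∘ₗ avgAdj wX (fun z => g.len z ^ d) q) y y''| ≤
      κ₁ * κ₂ * C * g.len y ^ 2 * Real.exp (-(1 / 2 * δ₀ * g.dist y y'')) := by
  have hlen : ∀ z : g.Site, 0 < g.len z ^ d := fun z => pow_pos (mul_pos (pow_pos hL _) hη) d
  intro y y''
  rw [mul_kernelW (fun z => (hlen z).ne') _ y y'']
  exact ineq2142_of_2136 G q R g.len g.dist hwX hlen hC hκ₂ hqR hq1 hq2 h2136 y y''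

/-- … and the operator behind that kernel IS `QGQ*`. [cite: Balaban1984PropagatorsII, (2.142) p.248] -/
theorem kerOp_hX (g : Geometry) [DecidableEq g.Site] (d : ℕ) {Y : Type} [Fintype Y]
    (G : Module.End ℝ (Y → ℝ)) (q : g.Site → Y → ℝ) (wX : ℝ) (hL : 0 < g.L) (hη : 0 < g.eta) :
    kerOp (fun z => g.len z ^ d)
        (kernelW (fun z => g.len z ^ d) (avgOp q ∘ₗ G ∘ₗ avgAdj wX (fun z => g.len z ^ d) q)) =
      avgOp q ∘ₗ G ∘ₗ avgAdj wX (fun z => g.len z ^ d) q :=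
  kerOp_kernelW (fun _ => (pow_pos (mul_pos (pow_pos hL _) hη) d).ne') _

end Geometry

/-! ## §5 The averaging normalisation for the printed k-fold average `Q_k` ([Balaban1984PropagatorsI] (1.18)) -/

section Concrete

open LatticeFieldCalculus B5Eq118OneStroke
open scoped Classical

variable {P : Params}

/-- Straight contours are translates of one another: for fixed `μ, t` the map `x ↦ x + t e_μ` is injective, so AT MOST ONE
contour issuing from a given block site in the direction `μ` has a given bond as its `t`-th bond. [folklore] -/
private theorem runSite_injective {j : ℕ} (μ : Fin P.d) (t : ℕ) :
    Function.Injective (fun x : Site P j => runSite x μ t) := by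
  intro x x' h
  have h0 : runSite x μ t = runSite x' μ t := h
  have h' : ∀ ν, runSite x μ t ν = runSite x' μ t ν := fun ν => congrArg (fun f : Site P j => f ν) h0
  funext ν
  by_cases hν : ν = μ
  · subst hν
    have := h' ν
    simp only [runSite, Function.update_self] at this
    exact add_right_cancel this
  · have := h' ν
    simpa only [runSite, Function.update_of_ne hν] using this

/-- The pairs (block site, step) `(x, t) ∈ B^k(b₋) × [0, L^k)` indexing the bonds of the contours of (1.18).
[cite: Balaban1984PropagatorsI, (1.18) p.20] -/
noncomputable def contourPairs (k : ℕ) (b : PBond P k) : Finset (Site P 0 × ℕ) :=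
  iterBlock k b.src ×ˢ Finset.range (P.L ^ k)

/-- **The kernel of `Q_k`**: `q_k(b, β) = η^{d+1}·#{(x,t) : x ∈ B^k(b₋), t < L^k, the t-th bond of [x, x(b)] is β}`.
[cite: Balaban1984PropagatorsI, (1.18) p.20] -/
noncomputable def qIter (k : ℕ) (b : PBond P k) (β : PBond P 0) : ℝ :=
  P.eta k ^ (P.d + 1) * (((contourPairs k b).filter fun p => runBond p.1 b.dir p.2 = β).card : ℝ)

/-- `0 ≤ η`. [folklore] -/
private theorem eta_nonneg (k : ℕ) : 0 ≤ P.eta k := by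
  unfold Params.eta
  positivity

/-- `q_k ≥ 0`. [cite: Balaban1984PropagatorsI, (1.18) p.20] -/
theorem qIter_nonneg (k : ℕ) (b : PBond P k) (β : PBond P 0) : 0 ≤ qIter k b β :=
  mul_nonneg (pow_nonneg (eta_nonneg k) _) (Nat.cast_nonneg _)

/-- **`Q_k` is the averaging operator with kernel `q_k`**: `(Q_kA)(b) = Σ_β q_k(b,β)A(β)` (from the one-stroke formula (1.18),
`B5Eq118OneStroke.eq118`, by counting the contour bonds fibrewise; standing range `k ≤ m + K`).
[cite: Balaban1984PropagatorsI, (1.18) p.20] -/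
theorem bondAvgIter_eq_avgOp {k : ℕ} (hk : k ≤ P.m + P.K) (A : VecField P 0 ℝ) (b : PBond P k) :
    bondAvgIter k A b = avgOp (qIter k) A b := by
  rw [eq118 hk, avgOp_apply]
  have hseg : ∀ x : Site P 0, segSum A x b.dir (P.L ^ k) = ∑ t ∈ Finset.range (P.L ^ k), A (runBond x b.dir t) :=
    fun x => rfl
  simp only [hseg, smul_eq_mul, Finset.mul_sum]
  rw [← Finset.sum_product (s := iterBlock k b.src) (t := Finset.range (P.L ^ k))
    (f := fun p => P.eta k ^ (P.d + 1) * A (runBond p.1 b.dir p.2))]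
  rw [← Finset.sum_fiberwise (s := iterBlock k b.src ×ˢ Finset.range (P.L ^ k))
    (g := fun p => runBond p.1 b.dir p.2) (f := fun p => P.eta k ^ (P.d + 1) * A (runBond p.1 b.dir p.2))]
  refine Finset.sum_congr rfl fun β _ => ?_
  rw [Finset.sum_congr rfl (g := fun _ => P.eta k ^ (P.d + 1) * A β) fun p hp => by
    rw [(Finset.mem_filter.mp hp).2]]
  rw [Finset.sum_const, nsmul_eq_mul, qIter, contourPairs]
  ring

/-- **`Σ_β q_k(b,β) = 1`**: the total mass of the average is `η^{d+1}·(L^{kd} block sites)·(L^k bonds per contour) = 1`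
(standing range). [cite: Balaban1984PropagatorsI, (1.18) p.20] -/
theorem sum_qIter {k : ℕ} (hk : k ≤ P.m + P.K) (b : PBond P k) : ∑ β, qIter k b β = 1 := by
  have hcard : ∑ β : PBond P 0, (((contourPairs k b).filter fun p => runBond p.1 b.dir p.2 = β).card : ℝ) =
      ((contourPairs k b).card : ℝ) := by
    rw [Finset.card_eq_sum_card_fiberwise (f := fun p => runBond p.1 b.dir p.2) (t := Finset.univ)
      fun _ _ => Finset.mem_univ _]
    push_cast
    rfl
  simp only [qIter]
  rw [← Finset.mul_sum, hcard, contourPairs, Finset.card_product, card_iterBlock k hk, Finset.card_range]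
  have hL : (P.L : ℝ) ≠ 0 := Nat.cast_ne_zero.mpr P.L_pos.ne'
  unfold Params.eta
  simp only [Nat.cast_mul, Nat.cast_pow]
  rw [← pow_mul, ← pow_mul, ← pow_add, inv_pow, show P.d * k + k = k * (P.d + 1) by ring]
  exact inv_mul_cancel₀ (pow_ne_zero _ hL)

/-- `Σ_β |q_k(b,β)| = 1` (the hypothesis `hq1` of §3 with `κ₁ = 1`, exactly). [cite: Balaban1984PropagatorsI, (1.18) p.20] -/
theorem sum_abs_qIter {k : ℕ} (hk : k ≤ P.m + P.K) (b : PBond P k) : ∑ β, |qIter k b β| = 1 := by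
  rw [← sum_qIter hk b]
  exact Finset.sum_congr rfl fun β _ => abs_of_nonneg (qIter_nonneg k b β)

/-- At most `L^k` contour bonds of the block coincide with a given fine bond: the fibre of `β` under
`(x,t) ↦ (t-th bond of [x, x(b)])` injects into `[0, L^k)` by `(x,t) ↦ t` (`runSite_injective`). [folklore] -/
private theorem card_fibre_le (k : ℕ) (b : PBond P k) (β : PBond P 0) :
    ((contourPairs k b).filter fun p => runBond p.1 b.dir p.2 = β).card ≤ P.L ^ k := by
  calc ((contourPairs k b).filter fun p => runBond p.1 b.dir p.2 = β).card
      ≤ (Finset.range (P.L ^ k)).card := by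
        refine Finset.card_le_card_of_injOn (fun p => p.2) ?_ ?_
        · intro p hp
          have hp' := (Finset.mem_filter.mp hp).1
          exact (Finset.mem_product.mp hp').2
        · intro p hp p' hp' hpp
          have h1 := (Finset.mem_filter.mp hp).2
          have h2 := (Finset.mem_filter.mp hp').2
          simp only at hpp
          have hsrc : runSite p.1 b.dir p.2 = runSite p'.1 b.dir p'.2 := by
            have := congrArg PBond.src (h1.trans h2.symm)
            simpa [runBond] using this
          rw [hpp] at hsrc
          have hx : p.1 = p'.1 := runSite_injective b.dir p'.2 hsrc
          exact Prod.ext hx hpp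
    _ = P.L ^ k := Finset.card_range _

/-- **`q_k ≤ η^d`**: each fine bond carries at most the relative volume `η^{d+1}·L^k = η^d` of one fine site in the unit
block (the hypothesis `hq2` of §3 with `κ₂ = 1`, `w_X = η^d`, `W ≡ 1`). [cite: Balaban1984PropagatorsI, (1.18) p.20] -/
theorem qIter_le (k : ℕ) (b : PBond P k) (β : PBond P 0) : qIter k b β ≤ P.eta k ^ P.d := by
  have hL : (0 : ℝ) < P.L := Nat.cast_pos.mpr P.L_pos
  have hcount : (((contourPairs k b).filter fun p => runBond p.1 b.dir p.2 = β).card : ℝ) ≤ (P.L : ℝ) ^ k := by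
    exact_mod_cast card_fibre_le k b β
  calc qIter k b β ≤ P.eta k ^ (P.d + 1) * (P.L : ℝ) ^ k :=
        mul_le_mul_of_nonneg_left hcount (pow_nonneg (eta_nonneg k) _)
    _ = P.eta k ^ P.d := by
        unfold Params.eta
        rw [pow_succ, mul_assoc, ← mul_pow, inv_mul_cancel₀ hL.ne', one_pow, mul_one]

/-- **The averaging normalisation of `Q_k`, PROVED**: `Σ_β|q_k(b,β)| ≤ 1` and `|q_k(b,β)| ≤ 1·η^d/1` — the hypotheses `hq1`,
`hq2` of `ineq2142_of_2136` with `κ₁ = κ₂ = 1`, fine weight `w_X = η^d`, unit weights on `T^{(k)}` (standing range).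
[cite: Balaban1984PropagatorsI, (1.18) p.20] -/
theorem qIter_normalisation {k : ℕ} (hk : k ≤ P.m + P.K) :
    (∀ b : PBond P k, ∑ β, |qIter k b β| ≤ 1) ∧
      (∀ (b : PBond P k) (β : PBond P 0), |qIter k b β| ≤ 1 * P.eta k ^ P.d / (fun _ => (1 : ℝ)) b) := by
  refine ⟨fun b => (sum_abs_qIter hk b).le, fun b β => ?_⟩
  rw [abs_of_nonneg (qIter_nonneg k b β), one_mul, div_one]
  exact qIter_le k b β

/-- **(2.142) for the printed one-level average `Q_k`** (unit lattice `T^{(k)}`, `W ≡ 1`, `ℓ ≡ 1`, fine weight `η^d`):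
for any linear `G` on the fine bond fields with the first entry of (2.136) in operator form relative to regions
`R(b) ⊇ supp q_k(b,·)`, `|(Q_kGQ_k*δ_{b′})(b)| ≤ C·e^{−δ₃ρ(b,b′)}` — no normalisation hypothesis left.
[cite: Balaban1984PropagatorsII, (2.142) p.248] -/
theorem ineq2142_bondAvgIter {k : ℕ} (hk : k ≤ P.m + P.K) (G : Module.End ℝ (VecField P 0 ℝ))
    (R : PBond P k → Set (PBond P 0)) (ρ : PBond P k → PBond P k → ℝ) {C δ₃ : ℝ} (hC : 0 ≤ C)
    (hqR : ∀ b β, qIter k b β ≠ 0 → β ∈ R b)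
    (h2136 : ∀ (b b' : PBond P k) (J : VecField P 0 ℝ) (M : ℝ), (∀ x, J x ≠ 0 → x ∈ R b') → (∀ x, |J x| ≤ M) →
      ∀ x ∈ R b, |G J x| ≤ C * (1 : ℝ) ^ 2 * Real.exp (-(δ₃ * ρ b b')) * M)
    (b b' : PBond P k) :
    |mat (avgOp (qIter k) ∘ₗ G ∘ₗ avgAdj (P.eta k ^ P.d) (fun _ => (1 : ℝ)) (qIter k)) b b'| ≤
      C * Real.exp (-(δ₃ * ρ b b')) := by
  have hη : 0 < P.eta k ^ P.d := pow_pos (by unfold Params.eta; have := P.L_pos; positivity) _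
  obtain ⟨hq1, hq2⟩ := qIter_normalisation (P := P) hk
  have h := ineq2142_of_2136 G (qIter k) R (fun _ => (1 : ℝ)) ρ hη (fun _ => one_pos) hC zero_le_one hqR hq1 hq2
    h2136 b b'
  simpa using h

/-- `Q_k` itself is recovered from the kernel: `avgOp (qIter k) A = Q_kA` (standing range). [cite: Balaban1984PropagatorsI, (1.18) p.20] -/
theorem avgOp_qIter_eq {k : ℕ} (hk : k ≤ P.m + P.K) (A : VecField P 0 ℝ) : avgOp (qIter k) A = bondAvgIter k A :=
  funext fun b => (bondAvgIter_eq_avgOp hk A b).symm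

end Concrete

/-! ## §6 (2.144), first equality: the rescaling of the form `⟨B, (QG_□Q*)B⟩` from the `η`-scale to the `ξ`-scale
(v1.1, APPEND-ONLY, unit `lit-balaban-r03` gen 5; SKELETON row `B6.Eq2.144`, whose (2.144)₂–(2.147) are `…B6Eq2144` (p22)) -/

section Rescaling

variable {X S : Type} [Fintype X] [Fintype S]

/-- The pairing (2.69) is linear in its second slot: `⟨B, cB′⟩ = c⟨B, B′⟩`. [cite: Balaban1984PropagatorsII, (2.69) p.235] -/
theorem pairS_smul_right (W : S → ℝ) (B B' : S → ℝ) (c : ℝ) : pairS W B (c • B') = c * pairS W B B' := by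
  simp only [pairS, Pi.smul_apply, smul_eq_mul, Finset.mul_sum]
  exact Finset.sum_congr rfl fun _ _ => by ring

/-- Rescaling the weights of (2.69): `W_η(b) = (L^jη)^d·W_ξ(b)` multiplies the pairing by `(L^jη)^d` (*"the last scalar product
above is on the unit scale"*, p. 248). [cite: Balaban1984PropagatorsII, (2.144) p.248] -/
theorem pairS_scale (s : ℝ) (d : ℕ) (W : S → ℝ) (B B' : S → ℝ) :
    pairS (fun b => s ^ d * W b) B B' = s ^ d * pairS W B B' := by
  simp only [pairS, Finset.mul_sum]
  exact Finset.sum_congr rfl fun _ _ => by ring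

omit [Fintype X] in
/-- The adjoint `Q*` is scale-free: with both pairings rescaled by the same factor `(L^jη)^d` (`η^d = (L^jη)^dξ^d`,
`W_η = (L^jη)^dW_ξ`) the adjoint of the (scale-free) average `Q` is unchanged. [cite: Balaban1984PropagatorsII, (2.144) p.248] -/
theorem avgAdj_scale {s : ℝ} (hs : s ≠ 0) (d : ℕ) (wX : ℝ) (W : S → ℝ) (q : S → X → ℝ) :
    avgAdj (s ^ d * wX) (fun b => s ^ d * W b) q = avgAdj wX W q := by
  refine LinearMap.ext fun B => funext fun x => ?_
  simp only [avgAdj_apply]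
  have hsum : ∑ b, s ^ d * W b * q b x * B b = s ^ d * ∑ b, W b * q b x * B b := by
    rw [Finset.mul_sum]
    exact Finset.sum_congr rfl fun _ _ => by ring
  rw [hsum, mul_inv, mul_assoc, ← mul_assoc wX⁻¹, mul_comm wX⁻¹ (s ^ d), mul_assoc, ← mul_assoc ((s ^ d)⁻¹),
    inv_mul_cancel₀ (pow_ne_zero d hs), one_mul]

/-- **(2.144), first equality** (p. 248, verbatim: *"⟨B, (QG_□Q*)↾_□B⟩ = (L^jη)^{d+2}⟨B, (QG^ξ_□Q*)↾_□B⟩ … and the last scalar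
product above is on the unit scale"*): with `G^η_□ = (L^jη)²G^ξ_□` ((2.94), `…B6Eq294Scaling`), the η-scale pairings
`η^d = (L^jη)^dξ^d` (fine) and `W_η = (L^jη)^dW_ξ` ((2.69)), and the scale-free average `Q` (hence the same `Q*`,
`avgAdj_scale`), the quadratic form rescales by `(L^jη)^{d+2}`; the restriction `↾_□` is the same on both sides (take `B`
supported in □), so the identity for every `B` contains the printed one. [cite: Balaban1984PropagatorsII, (2.144) p.248] -/
theorem eq2144_rescaling {s : ℝ} (hs : s ≠ 0) (d : ℕ) (wX : ℝ) (W : S → ℝ) (q : S → X → ℝ)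
    (Gxi : Module.End ℝ (X → ℝ)) (B : S → ℝ) :
    pairS (fun b => s ^ d * W b) B
        ((avgOp q ∘ₗ ((s ^ 2) • Gxi) ∘ₗ avgAdj (s ^ d * wX) (fun b => s ^ d * W b) q) B) =
      s ^ (d + 2) * pairS W B ((avgOp q ∘ₗ Gxi ∘ₗ avgAdj wX W q) B) := by
  rw [avgAdj_scale hs, LinearMap.smul_comp, LinearMap.comp_smul, LinearMap.smul_apply, pairS_scale,
    pairS_smul_right, pow_add]
  ring

end Rescaling

end Literature.MathematicalPhysics.QuantumFieldTheory.Balaban1983to89.B6Ineq2142
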